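import Summits.KontsevichZagierPeriods.KontsevichZagierPeriods.Theorems.RootDecompZetaThreeFrontierRungFourPreludeP06

/-! # `RootDecompZetaThreeFrontierRungFourPreludeP07` — part 7/14 of the mechanical ≤400-line split of `pre_src.lean` (sha256 ba362a5194d75c20…)
Source: decomp-kz lens-1 g12/g13 rung-4 prelude = Prelude_v3.lean @ba362a51 (Basis22_v1 sections RotFour/Shuffle/ProdFour/GenFb/WordMoves/RungFour/Basis22 + FacetGeneric_v2 §1–§23; critic CLEARED g6 row 330 / g6-20 l.1368); --supports stmt-KontsevichZagierPeriods-27141.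
Split by census-1 g10 `gen/splitlean.py`: scopes re-opened with their `open`/`variable`/`set_option` context; mathematics and declaration order unchanged. -/

set_option linter.dupNamespace false
noncomputable section
namespace Summit.KontsevichZagierPeriods.KontsevichZagierPeriods.Cruxes.GZNormalFormWThree.GZLadder.RungFour
open Set MeasureTheory Literature.NumberTheory.Transcendental
open Summit.KontsevichZagierPeriods.RootDecompZetaThreeFrontier
open Summit.KontsevichZagierPeriods.KontsevichZagierPeriods.Theorems.RootDecompZetaThreeFrontierWordEdge (GZNormalFormW)

open Set MeasureTheory Literature.NumberTheory.Transcendental in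
open Summit.KontsevichZagierPeriods.RootDecompZetaThreeFrontier in
open Summit.KontsevichZagierPeriods.KontsevichZagierPeriods.Theorems.RootDecompZetaThreeFrontierWordEdge (GZNormalFormW) in
/-- Auxiliary step `words_mono` (§0): words mono. [bookkeeping] -/
private theorem words_mono {k K : ℕ} (h : k ≤ K) : words k ⊆ words K := by
  rintro x ⟨w, ε, q, s, hw, hd, hi, rfl⟩
  exact ⟨w, ε, q, s, hw.trans h, hd, hi, rfl⟩

open Set MeasureTheory MvPolynomial in
open Literature.NumberTheory.Transcendental in
open Literature.ModelTheory.ExponentialFields in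
open Summit.KontsevichZagierPeriods.KontsevichZagierPeriods.Cruxes.GZNormalFormWThree.GZLadder.Shuffle (topWords congInto_words_four_of_two_two) in
open Summit.KontsevichZagierPeriods.KontsevichZagierPeriods.Cruxes.GZNormalFormWThree.GZLadder.ProdFour (dom22 mem_dom22_iff mapB mapB_mem mapB_zero mapB_one mapB_two mapB_three Fb zeta22 Fb_mapB prodB_rel integrableOn_Fb measurableSet_dom22) in
/-- transitivity of congruence through a relation -/
private theorem congInto_of_sub_mem {T : Set KZ.FormalRep} {x m : KZ.FormalRep} (h : x - m ∈ KZ.relations)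
    (hm : CongInto T m) : CongInto T x := by
  obtain ⟨m', hm', h'⟩ := hm
  refine ⟨m', hm', ?_⟩
  have key := add_mem h h'
  rwa [sub_add_sub_cancel] at key

open Set MeasureTheory in
open Literature.NumberTheory.Transcendental in
open Literature.ModelTheory.ExponentialFields in
/-- Auxiliary step `congInto_mono`: cong Into mono. [bookkeeping] -/
private theorem congInto_mono {S T : Set KZ.FormalRep} (h : S ⊆ T) {x : KZ.FormalRep} (hx : CongInto S x) : CongInto T x := by
  obtain ⟨m, hm, hx⟩ := hx
  exact ⟨m, AddSubgroup.closure_mono h hm, hx⟩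

/-- the ladder predicate IS the conjunction of its slices (definitional up to currying) -/
theorem gzNormalFormW_iff_slices (K : ℕ) : GZNormalFormW K ↔ ∀ k ≤ K, GZSlice k := by
  constructor
  · rintro h k hk r ⟨hd, p, a, b, c, hi⟩
    exact h k hk r p a b c hd hi
  · intro h k hk r p a b c hd hi
    exact h k hk r ⟨hd, p, a, b, c, hi⟩

/-- **successor step of the ladder**: rung `K+1` = rung `K` ∧ slice `K+1` -/
theorem gzNormalFormW_succ_iff (K : ℕ) : GZNormalFormW (K + 1) ↔ GZNormalFormW K ∧ GZSlice (K + 1) := by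
  rw [gzNormalFormW_iff_slices, gzNormalFormW_iff_slices]
  constructor
  · exact fun h => ⟨fun k hk => h k (Nat.le_succ_of_le hk), h (K + 1) le_rfl⟩
  · rintro ⟨h, h'⟩ k hk
    rcases Nat.lt_or_ge k (K + 1) with hlt | hge
    · exact h k (Nat.lt_succ_iff.mp hlt)
    · obtain rfl : k = K + 1 := le_antisymm hk hge
      exact h'

/-- the ladder is monotone downwards -/
theorem gzNormalFormW_mono {K K' : ℕ} (hKK' : K ≤ K') (h : GZNormalFormW K') : GZNormalFormW K :=
  (gzNormalFormW_iff_slices K).2 fun k hk => (gzNormalFormW_iff_slices K').1 h k (hk.trans hKK')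

/-- **RUNG 4 of the ladder = the rung-3 THEOREM ∧ the dimension-4 slice** (`M_{0,7}`). -/
theorem gzNormalFormW_four_iff : GZNormalFormW 4 ↔ GZNormalFormW 3 ∧ GZSlice 4 := gzNormalFormW_succ_iff 3

/-! ## §2 Chords, frames, logarithmic (cellular) integrands -/

/-- the extended configuration `x₀ = 1 > x₁ = t₀ > ⋯ > x_k = t_{k-1} > x_{k+1} = 0` of a point of `Δ_k`
(the marked points of `M_{0,k+3}` other than `∞`, in the cell's order) -/
def xpt (k : ℕ) (t : Fin k → ℝ) (i : Fin (k + 2)) : ℝ :=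
  if h0 : (i : ℕ) = 0 then 1 else if hk : (i : ℕ) ≤ k then t ⟨(i : ℕ) - 1, by omega⟩ else 0

/-- a CHORD of the `(k+3)`-gon not through `∞`: a pair `i < j` in `Fin (k+2)` other than `(0, k+1)` (whose form would be
the constant `1 − 0`).  Its linear form `x_i − x_j` is the interval sum of the gaps `g_i + ⋯ + g_{j-1}`
(`g_l = x_l − x_{l+1}`, `l = 0 … k`, `Σ g_l = 1`): `t_{i-1} − t_{j-1}`, or `1 − t_{j-1}` (`i = 0`), or `t_{i-1}` (`j = k+1`). -/
structure Chord (k : ℕ) where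
  i : Fin (k + 2)
  j : Fin (k + 2)
  lt : i < j
  proper : ¬ ((i : ℕ) = 0 ∧ (j : ℕ) = k + 1)

/-- the linear form of a chord -/
def Chord.form {k : ℕ} (c : Chord k) (t : Fin k → ℝ) : ℝ := xpt k t c.i - xpt k t c.j

/-- the gap-indicator vector of a chord in `ℚ^{k+1}` -/
def Chord.vec {k : ℕ} (c : Chord k) : Fin (k + 1) → ℚ :=
  fun l => if (c.i : ℕ) ≤ l ∧ (l : ℕ) < c.j then 1 else 0

/-- a FRAME: `k` chords whose gap vectors together with the all-ones vector (`Σ gaps = 1`) form a basis of `ℚ^{k+1}`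
(equivalently: the `k` affine forms and the constant `1` are linearly independent; interval matrices are totally
unimodular, so a frame has Jacobian `±1` against `dt`). -/
def IsFrame {k : ℕ} (S : Fin k → Chord k) : Prop :=
  LinearIndependent ℚ (Fin.cons (fun _ : Fin (k + 1) => (1 : ℚ)) fun m => (S m).vec)

/-- LOGARITHMIC (cellular) integrands on a set `σ`: `ℚ`-combinations of frame monomials `q_S · ∏ₘ 1/(S m).form`.  On
`Δ_k` these are exactly the functions `f` with `f dt` in the `ℚ`-span of the top-degree logarithmic forms
`⋀ₘ dlog (S m).form` of `M_{0,k+3}` (Arnold–Brieskorn; BCS Thm 2.12: the `01` cell-forms are a basis). -/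
def IsLogOn (k : ℕ) (f : (Fin k → ℝ) → ℝ) (σ : Set (Fin k → ℝ)) : Prop :=
  ∃ (F : Finset (Fin k → Chord k)) (q : (Fin k → Chord k) → ℚ), (∀ S ∈ F, IsFrame S) ∧
    EqOn f (fun t => ∑ S ∈ F, (q S : ℝ) * ∏ m, 1 / (S m).form t) σ

/-- **cellular generators of dimension `k`**: `[Δ_k, f]` with `f` logarithmic — automatically CONVERGENT, since an
`IntegralRep` carries the absolute integrability of its integrand: these are the cell-zeta values of
Brown–Carr–Schneps (arXiv:0910.0122) on `M_{0,k+3}` (their convergent cohomology `H^k(M^δ_{0,k+3})`, of dimension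
1, 4, 22, 105?, … for k = 2, 3, 4, …; 22 for `k = 4` by their Remark 4.11). -/
def cellGens (k : ℕ) : Set KZ.FormalRep :=
  {x | ∃ s : KZ.IntegralRep k, s.domain = simplex k ∧ IsLogOn k s.integrand s.domain ∧ x = KZ.of s}

/-- all genus-zero data of dimension `< k`, as formal generators (dimension 3: `gzLETwo = gzLT 3`) -/
def gzLT (k : ℕ) : Set KZ.FormalRep := {x | ∃ (j : ℕ) (s : KZ.IntegralRep j), j < k ∧ IsGZ j s ∧ x = KZ.of s}

/-- Auxiliary step `gzLETwo_eq_gzLT_three` (§2): gz LETwo eq gz LT three. [bookkeeping] -/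
theorem gzLETwo_eq_gzLT_three : gzLETwo = gzLT 3 := by
  ext x; constructor
  · rintro ⟨j, s, hj, hs, rfl⟩; exact ⟨j, s, by omega, hs, rfl⟩
  · rintro ⟨j, s, hj, hs, rfl⟩; exact ⟨j, s, by omega, hs, rfl⟩

/-! ## §3 The two pieces of a slice and the proved seam -/

/-- **(A_k) POLAR REDUCTION** in dimension `k`: every genus-zero datum on `Δ_k` is congruent, modulo the moves, into the
subgroup generated by CONVERGENT CELLULAR integrals of dimension `k` and genus-zero data of dimension `< k`
(poles of order `≥ 2` lowered by integration by parts in each coordinate, numerators and dependent pole sets removed by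
chord partial fractions, free coordinates integrated out by Newton–Leibniz — the dimension-3 instance is
`stub_three_wlog ∘ stub_three_orders ∘ stub_gapClassMatch ∘ stub_three_layer`, all PROVED). -/
def PolarReduction (k : ℕ) : Prop :=
  ∀ r : KZ.IntegralRep k, IsGZ k r → CongInto (cellGens k ∪ gzLT k) (KZ.of r)

/-- **(C_k) CELL-ZETA REDUCTION** in dimension `k`: every convergent cellular integral on `Δ_k` is congruent, modulo the
moves, to words of weight `≤ k` and genus-zero data of dimension `< k` (Brown–Carr–Schneps: dihedral relations =
rule 2 for the automorphisms of `M_{0,k+3}` stabilising the cell; product-map relations = Fubini + rule 2 + rule 1a;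
for `k + 3 ≤ 9` their computer calculation reduces the formal cell-zeta space to dimension `d_k`). -/
def CellZeta (k : ℕ) : Prop := ∀ x ∈ cellGens k, CongInto (words k ∪ gzLT k) x

/-- lower slices absorb the lower-dimensional generators -/
theorem congInto_words_of_lower {k : ℕ} (hlow : ∀ j < k, GZSlice j) {x : KZ.FormalRep}
    (hx : CongInto (words k ∪ gzLT k) x) : CongInto (words k) x := by
  refine congInto_trans (fun y hy => ?_) hx
  rcases hy with hy | ⟨j, s, hj, hs, rfl⟩
  · exact congInto_self hy
  · exact congInto_mono (words_mono hj.le) (hlow j hj s hs)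

/-- **THE SEAM (PROVED)**: lower slices + polar reduction + cell-zeta reduction give the slice. -/
theorem gzSlice_of {k : ℕ} (hlow : ∀ j < k, GZSlice j) (hA : PolarReduction k) (hC : CellZeta k) : GZSlice k := by
  intro r hr
  refine congInto_trans (fun y hy => ?_) (hA r hr)
  rcases hy with hy | ⟨j, s, hj, hs, rfl⟩
  · exact congInto_words_of_lower hlow (hC y hy)
  · exact congInto_mono (words_mono hj.le) (hlow j hj s hs)

/-- **the successor step with its two pieces**: `GZNormalFormW K → PolarReduction (K+1) → CellZeta (K+1) → GZNormalFormW (K+1)`. -/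
theorem gzNormalFormW_succ_of {K : ℕ} (hK : GZNormalFormW K) (hA : PolarReduction (K + 1)) (hC : CellZeta (K + 1)) :
    GZNormalFormW (K + 1) :=
  (gzNormalFormW_succ_iff K).2 ⟨hK, gzSlice_of
    (fun j hj => (gzNormalFormW_iff_slices K).1 hK j (Nat.lt_succ_iff.mp hj)) hA hC⟩

/-! ## §4 Rung 4 (`M_{0,7}`) -/

/-- **RUNG 4 from the rung-3 theorem and the two dimension-4 pieces.**  `h3` is `GZLadder.RungThree.GZNormalFormWThree_kernel`
(gen 12, landing kit; by name `Theses.RootDecompZetaThreeFrontier.GZNormalFormWThree` unfolds to `GZNormalFormW 3`). -/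
theorem gzNormalFormW_four_of (h3 : GZNormalFormW 3) (hA : PolarReduction 4) (hC : CellZeta 4) : GZNormalFormW 4 :=
  gzNormalFormW_succ_of h3 hA hC

/-- the rung-3 hypothesis BY THE ROUTE ITEM'S NAME (item 32433 `GZNormalFormWThree` is literally `GZNormalFormW 3`) -/
theorem gzNormalFormW_four_of_item
    (h3 : Summit.KontsevichZagierPeriods.KontsevichZagierPeriods.Theses.RootDecompZetaThreeFrontier.GZNormalFormWThree)
    (hA : PolarReduction 4) (hC : CellZeta 4) : GZNormalFormW 4 :=
  gzNormalFormW_four_of h3 hA hC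

/-- conversely the slice pieces are not idle: rung 4 contains the slice (trivial direction of §1) -/
theorem gzSlice_four_of (h : GZNormalFormW 4) : GZSlice 4 := ((gzNormalFormW_succ_iff 3).1 h).2

/-! ## §5 Sanity: the four kinds of chord forms in dimension 4, by `decide`-free computation -/

/-- the prefix chord `(0, j)`: form `1 − t_{j-1}` -/
example (t : Fin 4 → ℝ) : (⟨0, 2, by decide, by decide⟩ : Chord 4).form t = 1 - t 1 := by
  simp [Chord.form, xpt]
/-- the suffix chord `(i, k+1)`: form `t_{i-1}` -/
example (t : Fin 4 → ℝ) : (⟨3, 5, by decide, by decide⟩ : Chord 4).form t = t 2 := by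
  simp [Chord.form, xpt]
/-- an inner chord `(i, j)`: form `t_{i-1} − t_{j-1}` (here the long diagonal `t₀ − t₃` of the heptagon cell) -/
example (t : Fin 4 → ℝ) : (⟨1, 4, by decide, by decide⟩ : Chord 4).form t = t 0 - t 3 := by
  simp [Chord.form, xpt]
/-- its gap vector: `t₀ − t₃ = g₁ + g₂ + g₃` -/
example : (⟨1, 4, by decide, by decide⟩ : Chord 4).vec = ![0, 1, 1, 1, 0] := by
  funext l; fin_cases l <;> simp [Chord.vec]

/-! ## §5 (C_k) FROM A FINITE BASIS CERTIFICATE — the shape of the remaining work on rung 4 (RUNG4 §19)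

For `k = 4` the convergent space `C ⊂ V` of frame combinations (dim 22 inside dim 120, BCS Remark 4.11) has a basis
of 21 dihedral images of the word forms `ζ(4), ζ(3,1), ζ(2,2)` and the frame monomial `F_b = 1/(t₀(1−t₃)(t₁−t₃)(t₀−t₂))`
(= `Φ_B^*(ω_{ζ(2)} ⊗ ω_{ζ(2)})`), each of which is congruent into `words 4` by rule 2 (rotation / reflection / the
product chart `Φ_B`) and the shuffle.  The two hypotheses below are exactly (JOB C) the certificate and (templates) the
basis moves; the conclusion is `CellZeta k`. -/

/-- Auxiliary step `congInto_zero` (§5): cong Into zero. [bookkeeping] -/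
theorem congInto_zero {T : Set KZ.FormalRep} : CongInto T 0 := ⟨0, zero_mem _, by simp⟩

/-- Auxiliary step `congInto_add` (§5): cong Into add. [bookkeeping] -/
theorem congInto_add {T : Set KZ.FormalRep} {x y : KZ.FormalRep} (hx : CongInto T x) (hy : CongInto T y) :
    CongInto T (x + y) := by
  obtain ⟨m₁, hm₁, h₁⟩ := hx
  obtain ⟨m₂, hm₂, h₂⟩ := hy
  refine ⟨m₁ + m₂, add_mem hm₁ hm₂, ?_⟩
  have key := add_mem h₁ h₂
  rwa [show x - m₁ + (y - m₂) = x + y - (m₁ + m₂) by abel] at key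

/-- Auxiliary step `congInto_sum` (§5): cong Into sum. [bookkeeping] -/
theorem congInto_sum {T : Set KZ.FormalRep} {ι : Type*} (s : Finset ι) (f : ι → KZ.FormalRep)
    (h : ∀ i ∈ s, CongInto T (f i)) : CongInto T (∑ i ∈ s, f i) := by
  classical
  induction s using Finset.induction_on with
  | empty => simpa using (congInto_zero (T := T))
  | insert a s ha ih =>
    rw [Finset.sum_insert ha]
    exact congInto_add (h a (Finset.mem_insert_self a s)) (ih fun i hi => h i (Finset.mem_insert_of_mem hi))

/-- **(C_k) FROM A BASIS CERTIFICATE.**  Let `B₀, …, B_n` be functions on `Δ_k` such that every rational multiple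
`c · Bᵢ` is the integrand of a representation on `Δ_k` congruent into `T` (the BASIS MOVES), and every integrable
logarithmic integrand on `Δ_k` agrees on `Δ_k` with a `ℚ`-combination of the `Bᵢ` (the CERTIFICATE).  Then every
cellular generator of dimension `k` is congruent into `T` (iterated integrand additivity, rule 1b). -/
theorem congInto_cellGens_of_basis {k n : ℕ} {T : Set KZ.FormalRep} (B : Fin (n + 1) → (Fin k → ℝ) → ℝ)
    (hB : ∀ (i : Fin (n + 1)) (c : ℚ), ∃ r : KZ.IntegralRep k, r.domain = simplex k ∧
      EqOn r.integrand (fun t => (c : ℝ) * B i t) (simplex k) ∧ CongInto T (KZ.of r))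
    (hcert : ∀ s : KZ.IntegralRep k, s.domain = simplex k → IsLogOn k s.integrand s.domain →
      ∃ c : Fin (n + 1) → ℚ, EqOn s.integrand (fun t => ∑ i, (c i : ℝ) * B i t) (simplex k)) :
    ∀ x ∈ cellGens k, CongInto T x := by
  rintro x ⟨s, hsd, hlog, rfl⟩
  obtain ⟨c, hc⟩ := hcert s hsd hlog
  choose r hrd hri hrT using fun i => hB i (c i)
  have hrel : KZ.of s - KZ.of (r 0) - ∑ i : Fin n, KZ.of (r i.succ) ∈ KZ.relations := by
    refine KZ.of_sub_of_sub_sum_mem_relations n s (r 0) (fun i => r i.succ) (by rw [hrd, hsd])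
      (fun i => by rw [hrd, hsd]) fun x hx => ?_
    have hx' : x ∈ simplex k := hsd ▸ hx
    have e1 : s.integrand x = ∑ i, (c i : ℝ) * B i x := hc hx'
    have e2 : ∀ i, (r i).integrand x = (c i : ℝ) * B i x := fun i => hri i hx'
    show s.integrand x = (r 0).integrand x + ∑ i : Fin n, (r i.succ).integrand x
    rw [e1, Fin.sum_univ_succ, e2 0]
    exact congrArg _ (Finset.sum_congr rfl fun i _ => (e2 i.succ).symm)
  have hrel' : KZ.of s - (KZ.of (r 0) + ∑ i : Fin n, KZ.of (r i.succ)) ∈ KZ.relations := by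
    rwa [← sub_sub]
  exact congInto_of_sub_mem hrel'
    (congInto_add (hrT 0) (congInto_sum _ _ fun i _ => hrT i.succ))

/-- **`CellZeta k` from a basis certificate** (the form in which rung 4 will be closed: `n + 1 = 22`, `T = words 4`). -/
theorem cellZeta_of_basis {k n : ℕ} (B : Fin (n + 1) → (Fin k → ℝ) → ℝ)
    (hB : ∀ (i : Fin (n + 1)) (c : ℚ), ∃ r : KZ.IntegralRep k, r.domain = simplex k ∧
      EqOn r.integrand (fun t => (c : ℝ) * B i t) (simplex k) ∧ CongInto (words k ∪ gzLT k) (KZ.of r))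
    (hcert : ∀ s : KZ.IntegralRep k, s.domain = simplex k → IsLogOn k s.integrand s.domain →
      ∃ c : Fin (n + 1) → ℚ, EqOn s.integrand (fun t => ∑ i, (c i : ℝ) * B i t) (simplex k)) :
    CellZeta k :=
  congInto_cellGens_of_basis B hB hcert

/-- the same with target `words k` only (as the k = 4 blueprint delivers), weakened into `CellZeta k` -/
theorem cellZeta_of_basis_words {k n : ℕ} (B : Fin (n + 1) → (Fin k → ℝ) → ℝ)
    (hB : ∀ (i : Fin (n + 1)) (c : ℚ), ∃ r : KZ.IntegralRep k, r.domain = simplex k ∧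
      EqOn r.integrand (fun t => (c : ℝ) * B i t) (simplex k) ∧ CongInto (words k) (KZ.of r))
    (hcert : ∀ s : KZ.IntegralRep k, s.domain = simplex k → IsLogOn k s.integrand s.domain →
      ∃ c : Fin (n + 1) → ℚ, EqOn s.integrand (fun t => ∑ i, (c i : ℝ) * B i t) (simplex k)) :
    CellZeta k :=
  cellZeta_of_basis B (fun i c => by
    obtain ⟨r, h1, h2, h3⟩ := hB i c
    exact ⟨r, h1, h2, congInto_mono Set.subset_union_left h3⟩) hcert

end Summit.KontsevichZagierPeriods.KontsevichZagierPeriods.Cruxes.GZNormalFormWThree.GZLadder.RungFour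

namespace Summit.KontsevichZagierPeriods.KontsevichZagierPeriods.Cruxes.GZNormalFormWThree.GZLadder.Basis22

open Set MeasureTheory
open Literature.NumberTheory.Transcendental
open Summit.KontsevichZagierPeriods.RootDecompZetaThreeFrontier
open Summit.KontsevichZagierPeriods.KontsevichZagierPeriods.Cruxes.GZNormalFormWThree.GZLadder.ProdFour (Fb)
open Summit.KontsevichZagierPeriods.KontsevichZagierPeriods.Cruxes.GZNormalFormWThree.GZLadder.GenFb (basisMove_Fb')
open Summit.KontsevichZagierPeriods.KontsevichZagierPeriods.Cruxes.GZNormalFormWThree.GZLadder.WordMoves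
  (gen w0001 w0011 w0101 basisMove_word)
open Summit.KontsevichZagierPeriods.KontsevichZagierPeriods.Cruxes.GZNormalFormWThree.GZLadder.RungFour
  (CellZeta IsLogOn cellZeta_of_basis_words)

/-! ## §G  The 22-element blueprint basis and `CellZeta 4` from the certificate -/

/-- labels `(word, m, e)` of the 21 word images, in the order of `exp/k4_certificate_data_rot4.json`
(group index `2m + e`: word `0001` × {0,…,6}, words `0011`, `0101` × {0,2,3,4,5,6,7}). -/
def lab : Fin 21 → (Fin 4 → Bool) × ℕ × Bool :=
  ![(w0001, 0, false), (w0001, 0, true), (w0001, 1, false), (w0001, 1, true), (w0001, 2, false), (w0001, 2, true),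
    (w0001, 3, false),
    (w0011, 0, false), (w0011, 1, false), (w0011, 1, true), (w0011, 2, false), (w0011, 2, true), (w0011, 3, false),
    (w0011, 3, true),
    (w0101, 0, false), (w0101, 1, false), (w0101, 1, true), (w0101, 2, false), (w0101, 2, true), (w0101, 3, false),
    (w0101, 3, true)]

/-- Auxiliary step `lab_word` (§G): lab word. [bookkeeping] -/
theorem lab_word (i : Fin 21) : (lab i).1 = w0001 ∨ (lab i).1 = w0011 ∨ (lab i).1 = w0101 := by
  fin_cases i <;> simp [lab]

/-- **the blueprint basis** `B22` of the convergent logarithmic 4-forms on `Δ₄` (RUNG4 §19). -/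
def B22 : Fin 22 → (Fin 4 → ℝ) → ℝ :=
  Fin.snoc (fun i : Fin 21 => gen (lab i).1 (lab i).2.1 (lab i).2.2) Fb

/-- Auxiliary step `simplex_four` (§G): simplex four. [bookkeeping] -/
theorem simplex_four : simplex 4 = KZ.openOrderedSimplex 4 := rfl

/-- **ALL 22 BASIS MOVES, PROVED.** -/
theorem basisMoves_B22 (i : Fin 22) (c : ℚ) : ∃ r : KZ.IntegralRep 4, r.domain = simplex 4 ∧
    EqOn r.integrand (fun t => (c : ℝ) * B22 i t) (simplex 4) ∧ CongInto (words 4) (KZ.of r) := by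
  rw [simplex_four]
  induction i using Fin.lastCases with
  | last =>
    have e : B22 (Fin.last 21) = Fb := Fin.snoc_last _ _
    rw [e]
    exact basisMove_Fb' c
  | cast i =>
    have e : B22 (Fin.castSucc i) = gen (lab i).1 (lab i).2.1 (lab i).2.2 := Fin.snoc_castSucc _ _ _
    rw [e]
    exact basisMove_word (lab i).1 (lab_word i) (lab i).2.1 (lab i).2.2 c

/-- **`CellZeta 4` FROM THE ℚ-LINEAR CERTIFICATE ALONE (JOB C).**  If every logarithmic integrand of a representation on `Δ₄`
(convergent, since it IS the integrand of a representation) is a `ℚ`-combination of the 22 basis forms on `Δ₄`, then every cellular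
generator of dimension 4 is congruent into `words 4 ∪ gzLT 4` modulo the KZ moves. -/
theorem cellZeta_four_of_certificate
    (hcert : ∀ s : KZ.IntegralRep 4, s.domain = simplex 4 → IsLogOn 4 s.integrand s.domain →
      ∃ c : Fin 22 → ℚ, EqOn s.integrand (fun t => ∑ i, (c i : ℝ) * B22 i t) (simplex 4)) :
    CellZeta 4 :=
  cellZeta_of_basis_words B22 basisMoves_B22 hcert

/-! ### Flexibility: every dihedral image of `F_b` is a move too (so ANY 22 independent dihedral images of
`ω_0001, ω_0011, ω_0101, F_b` may serve as the certificate basis) -/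

open MvPolynomial Literature.ModelTheory.ExponentialFields in
/-- Auxiliary step `isSemialgebraicFunOn_Fb` (§G): is Semialgebraic Fun On Fb. [bookkeeping] -/
theorem isSemialgebraicFunOn_Fb : IsSemialgebraicFunOn ℚ (KZ.openOrderedSimplex 4) Fb := by
  refine (isSemialgebraicFunOn_aeval_div_aeval (KZ.isSemialgebraic_openOrderedSimplex 4)
    (C 1 : MvPolynomial (Fin 4) ℚ) (X 0 * (C 1 - X 3) * (X 1 - X 3) * (X 0 - X 2))
    fun t ht => ?_).congr fun t _ => ?_
  · obtain ⟨h3, h32, h21, h10, h0⟩ := (RotFour.mem_simplex_four_iff t).1 ht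
    have h1 : t 0 ≠ 0 := by linarith
    have h2 : (1 : ℝ) - t 3 ≠ 0 := by linarith
    have h4 : t 1 - t 3 ≠ 0 := by linarith
    have h5 : t 0 - t 2 ≠ 0 := by linarith
    simp only [map_mul, map_sub, MvPolynomial.aeval_X, map_one]
    exact mul_ne_zero (mul_ne_zero (mul_ne_zero h1 h2) h4) h5
  · simp only [Fb, map_mul, map_sub, MvPolynomial.aeval_X, map_one]

/-- Auxiliary step `goodS_Fb` (§G): good S Fb. [bookkeeping] -/
theorem goodS_Fb : WordMoves.GoodS Fb := by
  refine ⟨isSemialgebraicFunOn_Fb, fun c => ?_⟩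
  exact basisMove_Fb' c

/-- every dihedral image `(ρ^m δ^e)^* F_b` is a move into `words 4` -/
theorem basisMove_dihedral_Fb (m : ℕ) (e : Bool) (c : ℚ) : ∃ r : KZ.IntegralRep 4, r.domain = KZ.openOrderedSimplex 4 ∧
    EqOn r.integrand (fun t => (c : ℝ) *
      (if e then WordMoves.reflFun (WordMoves.rotFun^[m] Fb) else WordMoves.rotFun^[m] Fb) t) (KZ.openOrderedSimplex 4) ∧
    CongInto (words 4) (KZ.of r) := by
  cases e
  · simpa using (WordMoves.goodS_iterate goodS_Fb m).2 c
  · simpa using (WordMoves.goodS_refl (WordMoves.goodS_iterate goodS_Fb m)).2 c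

end Summit.KontsevichZagierPeriods.KontsevichZagierPeriods.Cruxes.GZNormalFormWThree.GZLadder.Basis22

end

/-! # ==== FacetGeneric_v2 (generic facet residues), prelude copies removed ==== -/

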